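import Mathlib
import Summits.NavierStokesRegularity.NavierStokesRegularity.Theses.RootDecompLitSlice
import Literature.Analysis.FluidPDE.LerayHopfConcatenation
import Summits.NavierStokesRegularity.NavierStokesRegularity.Theorems.EulerZoomLiouvillePowerGaugeEulerLiouvilleBackwardTools
import HarnessLib

/-!
# Route RootDecompLitSlice — support STg `GeneralWindowTradeoff` ⟨stmt-NavierStokesRegularity-27390⟩:
  registered stub (S) `stub_energyDrop_le_modulus` of the skeleton `free_window`
  (`Cruxes/GeneralWindowTradeoff/Lines/…`, namespace `…Cruxes.GeneralWindowTradeoff.FreeWindow`)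

ENERGY DROP ≤ 2‖u(0)‖₂ · L²-MODULUS on the Leray–Hopf frame. For a Leray–Hopf solution with zero
force on `[0, T)` (so `‖u(t)‖₂ ≤ ‖u(0)‖₂` for every `t ∈ [0, T]`, the accepted
`IsLerayHopfOn.kineticEnergy_le_of_zero_force`), every `t ∈ [0, T]` and every `H ≥ 0` with
`∫ |u(t) − u(T)|² ≤ H`:

  `‖u(t)‖₂² − ‖u(T)‖₂² = (‖u(t)‖₂ − ‖u(T)‖₂)(‖u(t)‖₂ + ‖u(T)‖₂) ≤ ‖u(t) − u(T)‖₂ · 2‖u(0)‖₂ ≤ 2‖u(0)‖₂ √H`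

(triangle inequality in `L²(ℝ³)`, `eLpNorm_add_le`; the conversion `eLpNorm f 2 = (∫⁻‖f‖ₑ²)^{1/2}` is the
landed `Theorems.PowerGaugeEulerLiouville.Backward.eLpNorm_two_eq_sqrt`). The theorem `stub_energyDrop_le_modulus` below
(namespace `…Theorems.GeneralWindowTradeoff`, the convention of the accepted
`Theorems/TypeIQuarterGateQuarterLawTypeIStubCountQuarterLaw.lean`) is character-for-character the
registered stub signature (skeleton sha256 ab1b91173537; the classical-solution and decay hypotheses are
carried but unused: the inequality is a Leray–Hopf fact).

HONEST FRAMING: elementary `L²` bookkeeping (size S); closes the registered stub (S) of the SUPPORT item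
STg only — the load-bearing stub (M) `stub_windowHardyEnergy` (Hardy + windowed energy identity + mean
value) remains, and STg itself is route-internal glue below ST ⟨31791⟩; nothing here bears on NS
regularity (rung 0). Lands `--supports stmt-NavierStokesRegularity-27390` (decomp-ns route-writer g36).
[folklore]
-/

set_option linter.dupNamespace false

noncomputable section

open MeasureTheory Set
open scoped ENNReal NNReal
open Literature.Analysis.FluidPDE

namespace Summit.NavierStokesRegularity.NavierStokesRegularity.Theorems.GeneralWindowTradeoff

namespace EnergyDrop

/-- For an `L²` field, `∫⁻ ‖f‖ₑ² = ofReal (∫ ‖f‖²)` (the accepted `eEnergy_eq_ofReal`, unfolded). [folklore] -/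
theorem lintegral_enorm_sq_eq_ofReal_integral
    (f : EuclideanSpace ℝ (Fin 3) → EuclideanSpace ℝ (Fin 3)) (hf : MemLp f 2 volume) :
    ∫⁻ x, ‖f x‖ₑ ^ 2 = ENNReal.ofReal (∫ x, ‖f x‖ ^ 2) := by
  have h := eEnergy_eq_ofReal f hf
  rw [eEnergy, VectorCalculus.kineticEnergy] at h
  rw [h]
  congr 1
  ring

/-- For an `L²` field, `eLpNorm f 2 = ofReal (√(∫ ‖f‖²))`. [folklore] -/
theorem eLpNorm_two_eq_ofReal_sqrt
    (f : EuclideanSpace ℝ (Fin 3) → EuclideanSpace ℝ (Fin 3)) (hf : MemLp f 2 volume) :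
    eLpNorm f 2 volume = ENNReal.ofReal (Real.sqrt (∫ x, ‖f x‖ ^ 2)) := by
  rw [PowerGaugeEulerLiouville.Backward.eLpNorm_two_eq_sqrt, lintegral_enorm_sq_eq_ofReal_integral f hf,
    ENNReal.ofReal_rpow_of_nonneg (integral_nonneg fun _ => sq_nonneg _) (by norm_num),
    Real.sqrt_eq_rpow]

/-- The `L²` norm of the slice difference is at most `√H` when `∫⁻ ‖u t − u T‖ₑ² ≤ ofReal H`. [folklore] -/
theorem eLpNorm_two_le_ofReal_sqrt {f : EuclideanSpace ℝ (Fin 3) → EuclideanSpace ℝ (Fin 3)} {H : ℝ}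
    (hH : 0 ≤ H) (h : ∫⁻ x, ‖f x‖ₑ ^ 2 ≤ ENNReal.ofReal H) :
    eLpNorm f 2 volume ≤ ENNReal.ofReal (Real.sqrt H) := by
  rw [PowerGaugeEulerLiouville.Backward.eLpNorm_two_eq_sqrt, Real.sqrt_eq_rpow,
    ← ENNReal.ofReal_rpow_of_nonneg hH (by norm_num)]
  exact ENNReal.rpow_le_rpow h (by norm_num)

end EnergyDrop

open EnergyDrop in
/-- **Registered stub `stub_energyDrop_le_modulus` (S) of the skeleton `free_window` of STg
`GeneralWindowTradeoff` ⟨stmt-NavierStokesRegularity-27390⟩, signature VERBATIM: ENERGY DROP ≤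
2‖u(0)‖₂ · L²-MODULUS** on the Leray–Hopf frame (energy monotonicity `‖u(t)‖₂, ‖u(T)‖₂ ≤ ‖u(0)‖₂`,
the accepted `IsLerayHopfOn.kineticEnergy_le_of_zero_force`, + the triangle inequality in `L²(ℝ³)`,
`eLpNorm_add_le`). The classical-solution and decay hypotheses are carried, unused. [folklore] -/
theorem stub_energyDrop_le_modulus :
    ∀ (ν T : ℝ), 0 < ν → 0 < T →
    ∀ (u : ℝ → EuclideanSpace ℝ (Fin 3) → EuclideanSpace ℝ (Fin 3))
      (p : ℝ → EuclideanSpace ℝ (Fin 3) → ℝ),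
      Literature.Analysis.FluidPDE.IsClassicalNSSolutionOn (Set.Ico 0 T) ν 0 u p →
      Literature.Analysis.FluidPDE.IsLerayHopfOn T ν 0 (u 0) u →
      Literature.Analysis.FluidPDE.HasRapidSpatialDecay (u 0) →
      ∀ t ∈ Set.Icc 0 T, ∀ H : ℝ, 0 ≤ H →
        ∫⁻ x, ‖u t x - u T x‖ₑ ^ 2 ≤ ENNReal.ofReal H →
        (∫ x, ‖u t x‖ ^ 2) - ∫ x, ‖u T x‖ ^ 2 ≤
          2 * Real.sqrt (∫ x, ‖u 0 x‖ ^ 2) * Real.sqrt H := by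
  intro ν T hν hT u p _hcl hLH _hdec t ht H hH hmod
  have hT' : T ∈ Icc 0 T := ⟨hT.le, le_rfl⟩
  have h0' : (0 : ℝ) ∈ Icc 0 T := ⟨le_rfl, hT.le⟩
  have hmt : MemLp (u t) 2 volume := hLH.memLp t ht
  have hmT : MemLp (u T) 2 volume := hLH.memLp T hT'
  -- abbreviations
  set A : ℝ := ∫ x, ‖u t x‖ ^ 2 with hA_def
  set B : ℝ := ∫ x, ‖u T x‖ ^ 2 with hB_def
  set E₀ : ℝ := ∫ x, ‖u 0 x‖ ^ 2 with hE_def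
  have hA0 : 0 ≤ A := integral_nonneg fun _ => sq_nonneg _
  have hB0 : 0 ≤ B := integral_nonneg fun _ => sq_nonneg _
  have hE0 : 0 ≤ E₀ := integral_nonneg fun _ => sq_nonneg _
  -- energy inequality (zero force): `A ≤ E₀`, `B ≤ E₀`
  have hAE : A ≤ E₀ := by
    have h := hLH.kineticEnergy_le_of_zero_force hν.le ht
    simp only [VectorCalculus.kineticEnergy] at h
    linarith
  have hBE : B ≤ E₀ := by
    have h := hLH.kineticEnergy_le_of_zero_force hν.le hT'
    simp only [VectorCalculus.kineticEnergy] at h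
    linarith
  -- triangle inequality in `L²`: `√A ≤ √H + √B`
  have htri : Real.sqrt A ≤ Real.sqrt H + Real.sqrt B := by
    have h1 : eLpNorm (u t) 2 volume ≤ eLpNorm (u t - u T) 2 volume + eLpNorm (u T) 2 volume := by
      have h := eLpNorm_add_le (hmt.1.sub hmT.1) hmT.1 (p := 2) (by norm_num) (μ := volume)
      simpa only [sub_add_cancel] using h
    rw [eLpNorm_two_eq_ofReal_sqrt (u t) hmt, eLpNorm_two_eq_ofReal_sqrt (u T) hmT] at h1
    have hdiff : eLpNorm (u t - u T) 2 volume ≤ ENNReal.ofReal (Real.sqrt H) :=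
      eLpNorm_two_le_ofReal_sqrt (f := u t - u T) hH hmod
    have h2 : ENNReal.ofReal (Real.sqrt A) ≤
        ENNReal.ofReal (Real.sqrt H) + ENNReal.ofReal (Real.sqrt B) :=
      h1.trans (add_le_add hdiff le_rfl)
    rw [← ENNReal.ofReal_add (Real.sqrt_nonneg _) (Real.sqrt_nonneg _)] at h2
    exact (ENNReal.ofReal_le_ofReal_iff (add_nonneg (Real.sqrt_nonneg _) (Real.sqrt_nonneg _))).1 h2
  -- real arithmetic: `A − B = (√A − √B)(√A + √B) ≤ √H · 2√E₀`
  have hsA : Real.sqrt A * Real.sqrt A = A := Real.mul_self_sqrt hA0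
  have hsB : Real.sqrt B * Real.sqrt B = B := Real.mul_self_sqrt hB0
  have hAle : Real.sqrt A ≤ Real.sqrt E₀ := Real.sqrt_le_sqrt hAE
  have hBle : Real.sqrt B ≤ Real.sqrt E₀ := Real.sqrt_le_sqrt hBE
  have hsH0 : 0 ≤ Real.sqrt H := Real.sqrt_nonneg _
  have hsA0 : 0 ≤ Real.sqrt A := Real.sqrt_nonneg _
  have hsB0 : 0 ≤ Real.sqrt B := Real.sqrt_nonneg _
  have hsE0 : 0 ≤ Real.sqrt E₀ := Real.sqrt_nonneg _
  have key : A - B = (Real.sqrt A - Real.sqrt B) * (Real.sqrt A + Real.sqrt B) := by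
    nlinarith [hsA, hsB]
  rw [key]
  by_cases hle : Real.sqrt B ≤ Real.sqrt A
  · have hd : Real.sqrt A - Real.sqrt B ≤ Real.sqrt H := by linarith
    have hs : Real.sqrt A + Real.sqrt B ≤ 2 * Real.sqrt E₀ := by linarith
    calc (Real.sqrt A - Real.sqrt B) * (Real.sqrt A + Real.sqrt B)
        ≤ Real.sqrt H * (2 * Real.sqrt E₀) :=
          mul_le_mul hd hs (by linarith) hsH0
      _ = 2 * Real.sqrt E₀ * Real.sqrt H := by ring
  · have hneg : (Real.sqrt A - Real.sqrt B) * (Real.sqrt A + Real.sqrt B) ≤ 0 :=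
      mul_nonpos_of_nonpos_of_nonneg (by linarith) (by linarith)
    have hpos : 0 ≤ 2 * Real.sqrt E₀ * Real.sqrt H := by positivity
    linarith

end Summit.NavierStokesRegularity.NavierStokesRegularity.Theorems.GeneralWindowTradeoff
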